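import Literature.GroupTheory.Coxeter.RankThreeCoxeterGroups
import Literature.GroupTheory.Coxeter.SubgraphPositiveDefinite
import HarnessLib

/-!
# A Coxeter graph with a circuit is not positive definite; in positive type a circuit is all of `Γ` and is `Ã_n` — Humphreys 1990 §2.5, §2.7 (3), §6.4

Layer `Literature/GroupTheory/Coxeter`, namespace `Literature.GroupTheory.Coxeter`; lane `lit-hodgefound` (Track 2 foundations library; prover seat p13,
generation 28, twenty-first file — over `GeometricRepresentation` (`gram`, `form`, `e`), `FiniteCoxeterPositiveDefinite` (`posDef_gram_iff`, Theorem 6.4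
`finite_iff_posDef_gram`), `AffineCoxeterRadical` (`gram_nonpos`, `posSemidef_gram_iff`, radical lemmas, `gram_indecomposable_iff_connected`),
`LinearAlgebra/Matrix/IndecomposablePositiveSemidefinite` (§2.6 Proposition (a): `forall_ne_zero_of_mulVec_eq_zero`), `RankThreeCoxeterGroups` (`one_half_le_cos_pi_div`,
`cos_pi_div_eq_half_iff`) and `SubgraphPositiveDefinite` (`cos_pi_div_nat_injective`)).  A CIRCUIT in `Γ` is an injective `c : Fin n → B`, `n = k + 3 ≥ 3`, with
`c_i — c_{i+1}` adjacent (`m(c_i, c_{i+1}) ≠ 2`, indices mod `n`).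

* §1 the test vector `v = Σ_i α_{c_i}`: `B(v, v) = Σ_{i,j} a(c_i, c_j)` (`form_sum_e_sum_e`) and the termwise bound `a(c_i,c_j) ≤ δ_{ij} − ½[j = i+1] − ½[i = j+1]`
  (`gram_circuit_le`: `−cos(π/m) ≤ −1/2` on the circuit edges, `≤ 0` elsewhere), whose total is `n − n/2 − n/2 = 0` (`sum_circuitBound_eq_zero`); hence
  ★ `B(v, v) ≤ 0` (`form_self_circuit_nonpos`) with `v ≠ 0`.
* §2 ★★ **a Coxeter graph containing a circuit is not positive definite** (`not_posDef_gram_of_circuit`) — the mechanism behind «Since `Ã_n` (`n ≥ 2`) cannot be a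
  subgraph of `Γ`, `Γ` contains no circuits» — and ★★★ with Theorem 6.4 **every Coxeter group whose graph contains a circuit is infinite** (`infinite_of_circuit`;
  a finite Coxeter group has a circuit-free graph, `forall_not_circuit_of_finite`).
* §3 ★★ **§2.7 step (3) in positive type**: if `B` is positive semidefinite and `Γ` contains a circuit, then `B(v,v) = 0`, every circuit edge is labelled `3`
  (`label_eq_three_of_posSemidef_of_circuit`), there are no chords (`label_eq_two_of_posSemidef_of_circuit`), and if `Γ` is connected the circuit passes through
  every vertex (`surjective_of_posSemidef_of_circuit`) — `Γ` is the cycle `Ã_{n−1}`.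

Theorems only (no definition, no named fact, no `sorry`: net debt 0); no instance, no notation.

## Source, verbatim

J. E. Humphreys, *Reflection Groups and Coxeter Groups* (1990) [Humphreys1990] (held `book:humphreys1990-reflection-groups-coxeter-groups`, chunks p0037–p0038,
p0042, p0125; book pp. 33–34, 37, 133), §2.5 «Some positive semidefinite graphs»: Figure 2 lists `Ã_n` (`n ≥ 2`), a circuit of `n + 1` vertices with all labels `3`,
among the graphs whose matrix is «positive semidefinite (but not positive definite)», the null vector having all coordinates `1`; §2.7, proof of the classification
Theorem, step «(3) Since `Ã_n` (`n ≥ 2`) cannot be a subgraph of `Γ`, `Γ` contains no circuits»; §6.4 «**Theorem.** … (a) `W` is finite. (b) The bilinear form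
`B` is positive definite.»

## Proof notes

For the vector `v = Σ α_{c_i}` over a circuit `c_0, …, c_{n−1}`: `B(v,v) = n + Σ_{i≠j} a(c_i,c_j) ≤ n + 2·n·(−1/2) = 0`, since the `n` circuit edges contribute
`−cos(π/m) ≤ −1/2` twice each and all other pairs contribute `≤ 0`.  So `B` is not positive definite; if `B` is positive semidefinite then equality holds termwise,
forcing labels `3` on the circuit, `2` off it, and `v` is a null vector, whose coordinates are all nonzero when `Γ` is connected (§2.6 Proposition (a)).
-/

noncomputable section

open CoxeterSystem Real Matrix Literature.LinearAlgebra.Matrix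

namespace Literature.GroupTheory.Coxeter

variable {B : Type*} (M : CoxeterMatrix B) [Fintype B] [DecidableEq B] {k : ℕ}

/-! ### §1 The test vector `Σ α_{c_i}` -/

section TestVector

omit [Fintype B] [DecidableEq B] in
/-- `i + 1 ≠ i` in `Fin n`, `n ≥ 3`. [folklore] -/
private theorem fin_add_one_ne (i : Fin (k + 3)) : i + 1 ≠ i := by
  intro h
  simp at h

omit [Fintype B] [DecidableEq B] in
/-- `i + 2 ≠ i` in `Fin n`, `n ≥ 3`. [folklore] -/
private theorem fin_add_two_ne (i : Fin (k + 3)) : i + 1 + 1 ≠ i := by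
  intro h
  rw [add_assoc, add_eq_left] at h
  have h2 := congrArg Fin.val h
  rw [Fin.val_add, Fin.val_one, Fin.val_zero] at h2
  rw [Nat.mod_eq_of_lt (by omega)] at h2
  omega

/-- `B(Σ_i α_{c_i}, Σ_j α_{c_j}) = Σ_i Σ_j a(c_i, c_j)`. [cite: Humphreys1990, §2.3 p. 31, §2.5 p. 33] -/
theorem form_sum_e_sum_e (c : Fin (k + 3) → B) : form M (∑ i, e (c i)) (∑ i, e (c i)) = ∑ i, ∑ j, gram M (c i) (c j) := by
  rw [LinearMap.map_sum₂]
  refine Finset.sum_congr rfl fun i _ => ?_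
  rw [map_sum]
  refine Finset.sum_congr rfl fun j _ => ?_
  rw [gram_eq_form_e_e]

omit [Fintype B] in
/-- The coordinate of `Σ_i α_{c_i}` at `c_0` is `1`; in particular the vector is nonzero. [cite: Humphreys1990, §2.5 p. 33] -/
theorem sum_e_ne_zero (c : Fin (k + 3) → B) (hc : Function.Injective c) : (∑ i, e (c i) : B → ℝ) ≠ 0 := by
  intro h
  have h0 := congr_fun h (c 0)
  rw [Finset.sum_apply, Pi.zero_apply] at h0
  simp only [e, Pi.single_apply, hc.eq_iff, Finset.sum_ite_eq, Finset.mem_univ, if_true] at h0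
  exact one_ne_zero h0

omit [Fintype B] [DecidableEq B] in
/-- ★ **The termwise bound**: `a(c_i, c_j) ≤ δ_{ij} − ½[j = i+1] − ½[i = j+1]` — `a = 1` on the diagonal, `−cos(π/m) ≤ −1/2` on the circuit edges (`m ≥ 3` or
`∞`), `≤ 0` on all other pairs. [cite: Humphreys1990, §2.5 p. 33, §6.7 p. 138 («`a, b, c ≥ 1/2`»)] -/
theorem gram_circuit_le (c : Fin (k + 3) → B) (hc : Function.Injective c) (hadj : ∀ i, M (c i) (c (i + 1)) ≠ 2) (i j : Fin (k + 3)) :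
    gram M (c i) (c j) ≤ (if i = j then (1 : ℝ) else 0) + (if j = i + 1 then -1/2 else 0) + (if i = j + 1 then -1/2 else 0) := by
  by_cases hij : i = j
  · subst hij
    rw [gram_diag, if_pos rfl, if_neg (fin_add_one_ne i).symm]
    norm_num
  · rw [if_neg hij]
    have hne : c i ≠ c j := fun h => hij (hc h)
    by_cases h1 : j = i + 1
    · subst h1
      have h2 : ¬(i = i + 1 + 1) := fun h => fin_add_two_ne i h.symm
      rw [if_pos rfl, if_neg h2, gram_apply]
      have h3 := one_half_le_cos_pi_div (M.off_diagonal _ _ hne) (hadj i)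
      linarith
    · rw [if_neg h1]
      by_cases h2 : i = j + 1
      · subst h2
        rw [if_pos rfl, gram_symm M, gram_apply]
        have h3 := one_half_le_cos_pi_div (M.off_diagonal _ _ hne.symm) (hadj j)
        linarith
      · rw [if_neg h2]
        have h3 := gram_nonpos M hne
        linarith

omit [Fintype B] [DecidableEq B] in
/-- The bound sums to `n − n/2 − n/2 = 0`. [cite: Humphreys1990, §2.5 p. 33] -/
theorem sum_circuitBound_eq_zero :
    ∑ i : Fin (k + 3), ∑ j : Fin (k + 3), ((if i = j then (1 : ℝ) else 0) + (if j = i + 1 then -1/2 else 0) + (if i = j + 1 then -1/2 else 0)) = 0 := by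
  simp only [Finset.sum_add_distrib]
  have h1 : ∑ i : Fin (k + 3), ∑ j : Fin (k + 3), (if i = j then (1 : ℝ) else 0) = (k + 3 : ℕ) := by
    simp
  have h2 : ∑ i : Fin (k + 3), ∑ j : Fin (k + 3), (if j = i + 1 then (-1/2 : ℝ) else 0) = (k + 3 : ℕ) * (-1/2) := by
    simp
  have h3 : ∑ i : Fin (k + 3), ∑ j : Fin (k + 3), (if i = j + 1 then (-1/2 : ℝ) else 0) = (k + 3 : ℕ) * (-1/2) := by
    rw [Finset.sum_comm]
    simp
  rw [h1, h2, h3]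
  ring

/-- ★ **`B(v, v) ≤ 0` for `v = Σ_i α_{c_i}` over a circuit.** [cite: Humphreys1990, §2.5 p. 33 (`Ã_n` positive semidefinite, not definite), §2.7 (3) p. 37] -/
theorem form_self_circuit_nonpos (c : Fin (k + 3) → B) (hc : Function.Injective c) (hadj : ∀ i, M (c i) (c (i + 1)) ≠ 2) :
    form M (∑ i, e (c i)) (∑ i, e (c i)) ≤ 0 := by
  rw [form_sum_e_sum_e]
  calc ∑ i, ∑ j, gram M (c i) (c j)
      ≤ ∑ i : Fin (k + 3), ∑ j : Fin (k + 3), ((if i = j then (1 : ℝ) else 0) + (if j = i + 1 then -1/2 else 0) + (if i = j + 1 then -1/2 else 0)) :=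
        Finset.sum_le_sum fun i _ => Finset.sum_le_sum fun j _ => gram_circuit_le M c hc hadj i j
    _ = 0 := sum_circuitBound_eq_zero

end TestVector

/-! ### §2 Not positive definite; `W` infinite -/

section NotPosDef

/-- ★★ **A Coxeter graph containing a circuit is not positive definite** («`Ã_n` (`n ≥ 2`) cannot be a subgraph of `Γ`»). [cite: Humphreys1990, §2.7 (3) p. 37,
§2.5 p. 33] -/
theorem not_posDef_gram_of_circuit (c : Fin (k + 3) → B) (hc : Function.Injective c) (hadj : ∀ i, M (c i) (c (i + 1)) ≠ 2) : ¬(gram M).PosDef :=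
  fun h => (not_lt.2 (form_self_circuit_nonpos M c hc hadj)) ((posDef_gram_iff M).1 h _ (sum_e_ne_zero c hc))

variable {M} {W : Type*} [Group W] (cs : CoxeterSystem M W)

include cs in
/-- ★★★ **A Coxeter group whose graph contains a circuit is infinite** (Theorem 6.4). [cite: Humphreys1990, §6.4 Theorem p. 133, §2.7 (3) p. 37] -/
theorem infinite_of_circuit (c : Fin (k + 3) → B) (hc : Function.Injective c) (hadj : ∀ i, M (c i) (c (i + 1)) ≠ 2) : Infinite W := by
  by_contra h
  rw [not_infinite_iff_finite] at h
  exact not_posDef_gram_of_circuit M c hc hadj ((finite_iff_posDef_gram cs).1 h)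

include cs in
/-- … equivalently **the graph of a finite Coxeter group contains no circuit**. [cite: Humphreys1990, §2.7 (3) p. 37, §6.4 Theorem p. 133] -/
theorem forall_not_circuit_of_finite [Finite W] (c : Fin (k + 3) → B) (hc : Function.Injective c) : ∃ i, M (c i) (c (i + 1)) = 2 := by
  by_contra h
  push Not at h
  haveI := infinite_of_circuit cs c hc h
  exact not_finite W

end NotPosDef

/-! ### §3 Positive type: the circuit is `Ã_{n−1}` and is all of `Γ` -/

section PositiveType

/-- In positive type the test vector is a null vector: `B(v, v) = 0`. [cite: Humphreys1990, §2.5 p. 33, §2.7 (3) p. 37] -/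
theorem form_self_circuit_eq_zero (hpsd : (gram M).PosSemidef) (c : Fin (k + 3) → B) (hc : Function.Injective c) (hadj : ∀ i, M (c i) (c (i + 1)) ≠ 2) :
    form M (∑ i, e (c i)) (∑ i, e (c i)) = 0 :=
  le_antisymm (form_self_circuit_nonpos M c hc hadj) ((posSemidef_gram_iff M).1 hpsd _)

/-- In positive type the termwise bound is attained: `a(c_i, c_j) = δ_{ij} − ½[j = i+1] − ½[i = j+1]`. [cite: Humphreys1990, §2.7 (3) p. 37] -/
theorem gram_circuit_eq (hpsd : (gram M).PosSemidef) (c : Fin (k + 3) → B) (hc : Function.Injective c) (hadj : ∀ i, M (c i) (c (i + 1)) ≠ 2) (i j : Fin (k + 3)) :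
    gram M (c i) (c j) = (if i = j then (1 : ℝ) else 0) + (if j = i + 1 then -1/2 else 0) + (if i = j + 1 then -1/2 else 0) := by
  have hsum : ∑ i : Fin (k + 3), ∑ j : Fin (k + 3),
      (((if i = j then (1 : ℝ) else 0) + (if j = i + 1 then -1/2 else 0) + (if i = j + 1 then -1/2 else 0)) - gram M (c i) (c j)) = 0 := by
    simp only [Finset.sum_sub_distrib]
    rw [sum_circuitBound_eq_zero, ← form_sum_e_sum_e, form_self_circuit_eq_zero M hpsd c hc hadj, sub_self]
  have hnn : ∀ i j : Fin (k + 3), 0 ≤ ((if i = j then (1 : ℝ) else 0) + (if j = i + 1 then -1/2 else 0) + (if i = j + 1 then -1/2 else 0)) - gram M (c i) (c j) :=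
    fun i j => sub_nonneg.2 (gram_circuit_le M c hc hadj i j)
  have hi := (Finset.sum_eq_zero_iff_of_nonneg fun i _ => Finset.sum_nonneg fun j _ => hnn i j).1 hsum i (Finset.mem_univ i)
  have hij := (Finset.sum_eq_zero_iff_of_nonneg fun j _ => hnn i j).1 hi j (Finset.mem_univ j)
  linarith

/-- ★★ **The circuit edges are labelled `3`** (`a(c_i, c_{i+1}) = −1/2`): a positive-type graph contains only `Ã`-circuits. [cite: Humphreys1990, §2.7 (3) p. 37,
§2.5 Figure 2 p. 34] -/
theorem label_eq_three_of_posSemidef_of_circuit (hpsd : (gram M).PosSemidef) (c : Fin (k + 3) → B) (hc : Function.Injective c)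
    (hadj : ∀ i, M (c i) (c (i + 1)) ≠ 2) (i : Fin (k + 3)) : M (c i) (c (i + 1)) = 3 := by
  have h := gram_circuit_eq M hpsd c hc hadj i (i + 1)
  rw [if_neg (fin_add_one_ne i).symm, if_pos rfl, if_neg (fun h => fin_add_two_ne i h.symm), gram_apply] at h
  exact cos_pi_div_eq_half_iff.1 (by linarith)

/-- ★★ **There are no chords**: two circuit vertices that are not consecutive are not joined (`m = 2`). [cite: Humphreys1990, §2.7 (3) p. 37] -/
theorem label_eq_two_of_posSemidef_of_circuit (hpsd : (gram M).PosSemidef) (c : Fin (k + 3) → B) (hc : Function.Injective c)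
    (hadj : ∀ i, M (c i) (c (i + 1)) ≠ 2) {i j : Fin (k + 3)} (hij : i ≠ j) (h1 : j ≠ i + 1) (h2 : i ≠ j + 1) : M (c i) (c j) = 2 := by
  have h := gram_circuit_eq M hpsd c hc hadj i j
  rw [if_neg hij, if_neg h1, if_neg h2, add_zero, add_zero, gram_apply, neg_eq_zero] at h
  have h' : cos (π / (M (c i) (c j) : ℕ)) = cos (π / ((2 : ℕ) : ℕ)) := by
    rw [h, Nat.cast_ofNat, cos_pi_div_two]
  exact cos_pi_div_nat_injective h'

/-- ★★ **The circuit passes through every vertex of a connected positive-type graph**: the null vector `Σ α_{c_i}` has all coordinates nonzero (§2.6 Proposition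
(a)), so every `s ∈ S` is some `c_i` — «`Ã_n` cannot be a [proper] subgraph». [cite: Humphreys1990, §2.7 (3) p. 37, §2.6 Proposition (a) p. 35] -/
theorem surjective_of_posSemidef_of_circuit (hirr : (coxeterGraph M).Connected) (hpsd : (gram M).PosSemidef) (c : Fin (k + 3) → B)
    (hc : Function.Injective c) (hadj : ∀ i, M (c i) (c (i + 1)) ≠ 2) : Function.Surjective c := by
  haveI := hirr.nonempty
  have hker : gram M *ᵥ (∑ i, e (c i)) = 0 :=
    (mem_ker_form_iff_gram_mulVec M _).1 ((form_self_eq_zero_iff_mem_ker_form M hpsd _).1 (form_self_circuit_eq_zero M hpsd c hc hadj))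
  have hne := forall_ne_zero_of_mulVec_eq_zero hpsd (isZMatrix_gram M) ((gram_indecomposable_iff_connected M).2 hirr) hker (sum_e_ne_zero c hc)
  intro b
  by_contra hb
  push Not at hb
  apply hne b
  rw [Finset.sum_apply]
  exact Finset.sum_eq_zero fun i _ => by rw [e, Pi.single_apply, if_neg (fun h => hb i h.symm)]

end PositiveType

end Literature.GroupTheory.Coxeter
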